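import Summits.Ventures.HodgeRepro2.T5SU11ResolventGroundStateWeight
import Summits.Ventures.HodgeRepro2.T5SU11ResolventMonotoneDecay

/-!
# The order structure of the resolvent on the ground-state weighted space `W_1`

`G^I_λ` is linear in the source and order-REVERSING (`K_λ < 0`). On `W_1 = {g continuous on (0, ∞) : |g| ≤ D Ξ}`, which lies
in the class for every `λ > 1` (row 556), the class results of row 4xx hold with no decay hypothesis:

* `greenSolI_neg_source`, `greenSolI_const_mul_source` — **`G^I(−g) = −G^I g` and `G^I(c g) = c G^I g`** (for any basis);
* `greenSolI_antitone_ground` — **the comparison principle**: `g₁ ≤ g₂` on `(0, ∞)` ⇒ `G^I_λ g₂ ≤ G^I_λ g₁`;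
* `greenSolI_nonpos_ground`, `abs_greenSolI_le_neg_greenSolI_abs_ground` — `g ≥ 0` ⇒ `G^I_λ g ≤ 0` (for every source),
  and **`|G^I_λ g| ≤ −G^I_λ |g|`** for every `g ∈ W_1`;
* `abs_greenSolI_le_ground_of_comparison` — the sharp bound `|G^I_λ g| ≤ D Ξ/(λ − 1)²` of row 556 recovered from the
  comparison principle and `G^I_λ Ξ = −Ξ/(λ − 1)²`;
* `greenSolI_mono_lam_ground`, `abs_greenSolI_antitone_lam_ground` — **monotonicity in the spectral parameter**: for
  `g ≥ 0` and `1 < λ₂ ≤ λ`, `G^I_{λ₂} g ≤ G^I_λ g ≤ 0`, hence `|G^I_λ g| ≤ |G^I_{λ₂} g|`;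
* `iterate_sign_ground` — the iterates of a non-negative source alternate in sign (for every source).

Nothing is claimed about (N).

Blind lane: Mathlib + the HodgeRepro2 prefix only; no sorry; axioms ⊆ {propext, Classical.choice,
Quot.sound}.
-/

namespace Summit.Ventures.HodgeRepro2.T5SU11WeightedSpaceGroundStateOrder

open Filter Topology MeasureTheory
open Set (Ioi Ioc)
open T5SU11Cartan T5SU11SphericalFunction T5SU11SphericalDecay T5SU11RadialGreenImproper
  T5SU11RadialGreenImproperDecaySource T5SU11ResolventEigenfunction T5SU11ResolventMonotoneDecay
  T5SU11SphericalBounds T5SU11ResolventGroundStateWeight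

/-- **`G^I(−g) = −G^I g`** for any basis `φ, χ`. -/
theorem greenSolI_neg_source (φ χ g : ℝ → ℝ) (t : ℝ) :
    greenSolI φ χ (fun s => -g s) t = -greenSolI φ χ g t := by
  unfold greenSolI greenBI greenAI
  have e1 : (fun s => φ s * -g s * Real.sinh (2 * s)) = fun s => -(φ s * g s * Real.sinh (2 * s)) := by
    funext s; ring
  have e2 : (fun s => χ s * -g s * Real.sinh (2 * s)) = fun s => -(χ s * g s * Real.sinh (2 * s)) := by
    funext s; ring
  rw [e1, e2, MeasureTheory.integral_neg, MeasureTheory.integral_neg]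
  ring

/-- **`G^I(c g) = c G^I g`** for any basis `φ, χ`. -/
theorem greenSolI_const_mul_source (φ χ g : ℝ → ℝ) (c t : ℝ) :
    greenSolI φ χ (fun s => c * g s) t = c * greenSolI φ χ g t := by
  unfold greenSolI greenBI greenAI
  have e1 : (fun s => φ s * (c * g s) * Real.sinh (2 * s)) = fun s => c * (φ s * g s * Real.sinh (2 * s)) := by
    funext s; ring
  have e2 : (fun s => χ s * (c * g s) * Real.sinh (2 * s)) = fun s => c * (χ s * g s * Real.sinh (2 * s)) := by
    funext s; ring
  rw [e1, e2, MeasureTheory.integral_const_mul, MeasureTheory.integral_const_mul]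
  ring

section measure

variable [MeasurableSpace Circle] [BorelSpace Circle]

variable {lam : ℝ} (hlam : 1 < lam)

include hlam in
/-- **THE COMPARISON PRINCIPLE ON `W_1`**: `g₁ ≤ g₂` on `(0, ∞)` ⇒ `G^I_λ g₂ ≤ G^I_λ g₁` on `(0, ∞)`, for two sources in `W_1`. -/
theorem greenSolI_antitone_ground {g₁ g₂ : ℝ → ℝ} (hg₁ : ContinuousOn g₁ (Ioi 0)) (hg₂ : ContinuousOn g₂ (Ioi 0))
    {D₁ D₂ : ℝ} (hD₁ : ∀ s, 0 < s → |g₁ s| ≤ D₁ * sph 1 (hyp s)) (hD₂ : ∀ s, 0 < s → |g₂ s| ≤ D₂ * sph 1 (hyp s))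
    (hle : ∀ s, 0 < s → g₁ s ≤ g₂ s) {t : ℝ} (ht : 0 < t) :
    greenSolI (fun t => sph lam (hyp t)) (sphDecay lam) g₂ t ≤ greenSolI (fun t => sph lam (hyp t)) (sphDecay lam) g₁ t := by
  obtain ⟨hM₁, hD₁0, hε, C₁, hC₁⟩ := class_of_le_mul_sph_one hlam hD₁
  obtain ⟨hM₂, hD₂0, _, C₂, hC₂⟩ := class_of_le_mul_sph_one hlam hD₂
  exact greenSolI_antitone_source hlam hle (integrableOn_sph_mul_mul_sinh_Ioc hg₁ hM₁ hD₁0 lam)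
    (integrableOn_sphDecay_mul_mul_sinh hlam hg₁ hM₁ hD₁0 hε hC₁)
    (integrableOn_sph_mul_mul_sinh_Ioc hg₂ hM₂ hD₂0 lam) (integrableOn_sphDecay_mul_mul_sinh hlam hg₂ hM₂ hD₂0 hε hC₂) ht

include hlam in
/-- `g ≥ 0` on `(0, ∞)` ⇒ `G^I_λ g ≤ 0` on `(0, ∞)` (row 4xx; no hypothesis on `g` beyond the sign). -/
theorem greenSolI_nonpos_ground {g : ℝ → ℝ} (hg0 : ∀ s, 0 < s → 0 ≤ g s) {t : ℝ} (ht : 0 < t) :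
    greenSolI (fun t => sph lam (hyp t)) (sphDecay lam) g t ≤ 0 :=
  greenSolI_nonpos hlam hg0 ht

include hlam in
/-- **`|G^I_λ g| ≤ −G^I_λ |g|` on `(0, ∞)`** for every `g ∈ W_1` (the comparison principle applied to `−|g| ≤ g ≤ |g|`). -/
theorem abs_greenSolI_le_neg_greenSolI_abs_ground {g : ℝ → ℝ} (hg : ContinuousOn g (Ioi 0))
    {D : ℝ} (hD : ∀ s, 0 < s → |g s| ≤ D * sph 1 (hyp s)) {t : ℝ} (ht : 0 < t) :
    |greenSolI (fun t => sph lam (hyp t)) (sphDecay lam) g t|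
      ≤ -greenSolI (fun t => sph lam (hyp t)) (sphDecay lam) (fun s => |g s|) t := by
  have habs : ContinuousOn (fun s => |g s|) (Ioi 0) := hg.abs
  have hDabs : ∀ s, 0 < s → |(fun s => |g s|) s| ≤ D * sph 1 (hyp s) := fun s hs => by
    simp only [abs_abs]; exact hD s hs
  have hneg : ContinuousOn (fun s => -|g s|) (Ioi 0) := habs.neg
  have hDneg : ∀ s, 0 < s → |(fun s => -|g s|) s| ≤ D * sph 1 (hyp s) := fun s hs => by
    simp only [abs_neg, abs_abs]; exact hD s hs
  have h1 := greenSolI_antitone_ground hlam hneg hg hDneg hD (fun s _ => neg_abs_le (g s)) ht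
  have h2 := greenSolI_antitone_ground hlam hg habs hD hDabs (fun s _ => le_abs_self (g s)) ht
  rw [greenSolI_neg_source] at h1
  rw [abs_le]
  constructor <;> linarith

include hlam in
/-- **The sharp bound of row 556 from the comparison principle**: `|g| ≤ D Ξ` ⇒ `|G^I_λ g(t)| ≤ D Ξ(t)/(λ − 1)²`, since
`G^I_λ Ξ = −Ξ/(λ − 1)²`. -/
theorem abs_greenSolI_le_ground_of_comparison {g : ℝ → ℝ} (hg : ContinuousOn g (Ioi 0))
    {D : ℝ} (hD : ∀ s, 0 < s → |g s| ≤ D * sph 1 (hyp s)) {t : ℝ} (ht : 0 < t) :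
    |greenSolI (fun t => sph lam (hyp t)) (sphDecay lam) g t| ≤ D * sph 1 (hyp t) / (lam - 1) ^ 2 := by
  have habs : ContinuousOn (fun s => |g s|) (Ioi 0) := hg.abs
  have hDabs : ∀ s, 0 < s → |(fun s => |g s|) s| ≤ D * sph 1 (hyp s) := fun s hs => by
    simp only [abs_abs]; exact hD s hs
  have hD0 : 0 ≤ D := (class_of_le_mul_sph_one hlam hD).2.1
  have hΞ : ContinuousOn (fun s => D * sph 1 (hyp s)) (Ioi 0) := continuousOn_const.mul (sph_one_class hlam).1
  have hDΞ : ∀ s, 0 < s → |(fun s => D * sph 1 (hyp s)) s| ≤ D * sph 1 (hyp s) := fun s _ => by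
    simp only
    rw [abs_of_nonneg (mul_nonneg hD0 (sph_hyp_pos 1 s).le)]
  -- `|g| ≤ D Ξ` ⇒ `G^I_λ (D Ξ) ≤ G^I_λ |g|`, and `G^I_λ (D Ξ) = −D Ξ/(λ − 1)²`
  have h1 := greenSolI_antitone_ground hlam habs hΞ hDabs hDΞ (fun s hs => hD s hs) ht
  rw [greenSolI_const_mul_source, greenSolI_sph_one_eq hlam ht] at h1
  have h2 := abs_greenSolI_le_neg_greenSolI_abs_ground hlam hg hD ht
  have hden : lam * (lam - 2) + 1 = (lam - 1) ^ 2 := by ring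
  rw [hden] at h1
  calc |greenSolI (fun t => sph lam (hyp t)) (sphDecay lam) g t|
      ≤ -greenSolI (fun t => sph lam (hyp t)) (sphDecay lam) (fun s => |g s|) t := h2
    _ ≤ -(D * -(sph 1 (hyp t) / (lam - 1) ^ 2)) := by linarith
    _ = D * sph 1 (hyp t) / (lam - 1) ^ 2 := by ring

include hlam in
/-- **MONOTONICITY IN THE SPECTRAL PARAMETER ON `W_1`**: for `g ≥ 0` and `1 < λ₂ ≤ λ`, `G^I_{λ₂} g ≤ G^I_λ g ≤ 0`. -/
theorem greenSolI_mono_lam_ground {lam₂ : ℝ} (hlam₂ : 1 < lam₂) (hle : lam₂ ≤ lam) {g : ℝ → ℝ}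
    (hg : ContinuousOn g (Ioi 0)) {D : ℝ} (hD : ∀ s, 0 < s → |g s| ≤ D * sph 1 (hyp s))
    (hg0 : ∀ s, 0 < s → 0 ≤ g s) {t : ℝ} (ht : 0 < t) :
    greenSolI (fun t => sph lam₂ (hyp t)) (sphDecay lam₂) g t ≤ greenSolI (fun t => sph lam (hyp t)) (sphDecay lam) g t ∧
      greenSolI (fun t => sph lam (hyp t)) (sphDecay lam) g t ≤ 0 := by
  obtain ⟨hM, hD0, hε, C, hC⟩ := class_of_le_mul_sph_one hlam₂ hD
  have hε₁ : 2 - lam < (3 - lam₂) / 2 := by linarith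
  exact greenSolI_mono_lam hlam hlam₂ hg hM hD0 hε₁ hε hC hle hg0 ht

include hlam in
/-- For `g ≥ 0` in `W_1` and `1 < λ₂ ≤ λ`, `|G^I_λ g| ≤ |G^I_{λ₂} g|` on `(0, ∞)`. -/
theorem abs_greenSolI_antitone_lam_ground {lam₂ : ℝ} (hlam₂ : 1 < lam₂) (hle : lam₂ ≤ lam) {g : ℝ → ℝ}
    (hg : ContinuousOn g (Ioi 0)) {D : ℝ} (hD : ∀ s, 0 < s → |g s| ≤ D * sph 1 (hyp s))
    (hg0 : ∀ s, 0 < s → 0 ≤ g s) {t : ℝ} (ht : 0 < t) :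
    |greenSolI (fun t => sph lam (hyp t)) (sphDecay lam) g t| ≤ |greenSolI (fun t => sph lam₂ (hyp t)) (sphDecay lam₂) g t| := by
  obtain ⟨hM, hD0, hε, C, hC⟩ := class_of_le_mul_sph_one hlam₂ hD
  have hε₁ : 2 - lam < (3 - lam₂) / 2 := by linarith
  exact abs_greenSolI_antitone_lam hlam hlam₂ hg hM hD0 hε₁ hε hC hle hg0 ht

include hlam in
/-- **The iterates of a non-negative source alternate in sign**: `(−1)ⁿ (G^I_λ)ⁿ g ≥ 0` on `(0, ∞)` (row 4xx; no
hypothesis on `g` beyond the sign). -/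
theorem iterate_sign_ground {g : ℝ → ℝ} (hg0 : ∀ s, 0 < s → 0 ≤ g s) (n : ℕ) {t : ℝ} (ht : 0 < t) :
    0 ≤ (-1 : ℝ) ^ n * ((greenSolI (fun t => sph lam (hyp t)) (sphDecay lam))^[n] g) t :=
  iterate_sign (lam₂ := lam) hlam hg0 n ht

end measure

end Summit.Ventures.HodgeRepro2.T5SU11WeightedSpaceGroundStateOrder
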